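import Summits.RiemannHypothesis.RiemannHypothesis.Theorems.SoninBandEnergyAbstract
import Summits.RiemannHypothesis.RiemannHypothesis.Theorems.SoninBandEnergyEntry
import Summits.RiemannHypothesis.RiemannHypothesis.Theorems.GroundBartaEvenWinsBeyondArchDeflationPSD
import Mathlib.Algebra.Order.Chebyshev
import HarnessLib

/-!
# Band energy of time-limited functions, VI: the bound `∫_{−1}^{1} |𝓕 f|² ≤ 0.9999428 ‖f‖²`

Cell `rh-explicit`, seat cc-s2-3 (`HOME/cc-s2-3/CERT-PLAN.md` §7, sub-task E1 of lead ruling R4-10 (i)(a)).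
**Main theorem** (`integral_norm_sq_fourier_Icc_le`): for every `f ∈ L²(ℝ)` vanishing a.e. off `[−1, 1]`,
`∫_{[−1,1]} ‖𝓕 f(ξ)‖² dξ ≤ 0.9999428 · ∫ ‖f‖²`.  Equivalently, the largest eigenvalue `λ₀` of the time–band
limiting operator `P_{[−1,1]} 𝓕⁻¹ P_{[−1,1]} 𝓕 P_{[−1,1]}` (Slepian–Landau–Pollak, `c = 2π`; the pair of projections
behind Sonin's space `S(1,1)` of Connes–Consani 2021 §4) satisfies `1 − λ₀ ≥ 5.72·10⁻⁵` (numerically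
`λ₀ = 0.99994275335…`; CC 2021 print `√λ₀ ≈ 0.999971` as numerics; how this kernel-checked bound relates to the
printed non-asymptotic bounds on `1 − λ₀(c)` — Slepian, Fuchs, Landau–Widom, Osipov–Rokhlin–Xiao, Bonami–Karoui — is
the cell's open literature task LIT-ASKS L-4; no novelty claim is made here).  This is the quantitative input every
Sonin-space certificate of the cell needs (the distance of a band-clean vector to `S(1,1)`, E2 of lead ruling R5-1).

Proof = assembly: the abstract compression-plus-tail lemma (file I) in `L²[−1,1]` with `e_ξ = e^{2πixξ}` and the
Legendre polynomials `P_0..P_14` (file II: `⟪e_ξ,[f]⟫ = 𝓕 f ξ`, `‖e_ξ‖² = 2`); hypothesis (i) (compressed form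
`≤ aQ`) from the entry enclosures `‖M_jk − Mid_jk‖ ≤ 10⁻¹²` (file V, from the kernel checks of file IV) and the exact
`LDLᵀ` identity `shiftQ·G − Mid = L diag(d) Lᵀ`, `d ≥ 0` (file IV; quadratic-form bookkeeping
`dt_quadForm_ge_of_ldl` of `GroundBartaEvenWinsBeyondArchDeflationPSD`); hypothesis (ii) (tail `≤ tauQ`) from
`∫‖e_ξ − P_V e_ξ‖² = 4 − Σ_j Re M_jj/∫P_j²`; and `aQ + tauQ ≤ 0.9999428`.  Proof-only file; no facts, no axioms.
-/

set_option linter.dupNamespace false  -- the mandated namespace repeats `RiemannHypothesis`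

noncomputable section

open MeasureTheory Complex Set Finset
open scoped Real ComplexConjugate InnerProductSpace FourierTransform
open Summit.RiemannHypothesis.RiemannHypothesis.Theorems.SemilocalPolyWitness
open Literature.Analysis.ValidatedNumerics.NumericsMP
open Summit.RiemannHypothesis.RiemannHypothesis.Theorems.EvenWinsBeyondArch (dt_quadForm_ge_of_ldl)

namespace Summit.RiemannHypothesis.RiemannHypothesis.BandEnergy

/-! ## Unpacking the certificate -/

/-- The non-entry checks of file IV, as propositions. [folklore] -/
theorem cert_rest :
    (∀ j k : Fin 15, j ≠ k → gramQ j k = 0) ∧ (∀ j : Fin 15, (2 : ℚ) / 29 ≤ gramQ j j)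
    ∧ (∀ j k : Fin 15, midM j k = midM k j)
    ∧ (∀ i j : Fin 15, (if i = j then shiftQ * gramQ i i else 0) - midM i j = ∑ r : Fin 15, dVec r * lMat i r * lMat j r)
    ∧ (∀ r : Fin 15, 0 ≤ dVec r) ∧ (4 - ∑ j : Fin 15, (midM j j - radQ) / gramQ j j ≤ tauQ)
    ∧ (shiftQ + 15 * radQ / (2 / 29) ≤ aQ) ∧ (aQ + tauQ ≤ 9999428 / 10000000) ∧ 0 < aQ ∧ 0 < tauQ ∧ 6 ≤ mT := by
  have h := checkRest_eq_true
  simp only [checkRest, Bool.and_eq_true, decide_eq_true_eq] at h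
  obtain ⟨⟨⟨⟨⟨⟨⟨⟨⟨⟨⟨h1, h2⟩, h3⟩, h4⟩, h5⟩, h6⟩, h7⟩, h8⟩, h9⟩, h10⟩, h11⟩, -⟩ := h
  exact ⟨h1, h2, h3, h4, h5, h6, h7, h8, h9, h10, h11⟩

/-- The entry checks of file IV: an enclosure `U ∋ π²/16` and `entryOK U … (j,k)` for all `j ≤ k`. [folklore] -/
theorem cert_entries : ∃ U : MI, MI.mem scaleS (π ^ 2 / 16) U ∧
    ∀ j k : Fin 15, j ≤ k →
      entryOK U (legL j) (legL k) (ceList (legL j) mT, soList (legL j) mT) (ceList (legL k) mT, soList (legL k) mT)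
        (midM j k) = true := by
  cases hU : piSqOver16 with
  | none => have h0 := rowOK_all 0; simp [rowOK, hU] at h0
  | some U =>
    refine ⟨U, ?_, fun j k hjk => ?_⟩
    · obtain ⟨P, hP, rfl⟩ := Option.map_eq_some_iff.1 hU
      have hπ := MI.mem_pi scaleS hP
      have h2 := MI.mem_divNat (MI.mem_sqr scaleS_pos hπ) (n := 16) (by norm_num)
      convert h2 using 2
      norm_num
    · have hj := rowOK_all j
      simp only [rowOK, hU, List.all_eq_true, Bool.or_eq_true, decide_eq_true_eq] at hj
      rcases hj k (List.mem_finRange k) with h | h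
      · exact absurd hjk (not_le.2 h)
      · exact h

/-- **Every entry is enclosed**: `‖M_jk − Mid_jk‖ ≤ radQ` for all `j, k` (Hermitian symmetry for `j > k`). [folklore] -/
theorem norm_entry_sub_mid_le (j k : Fin 15) :
    ‖(∫ ξ in Icc (-1 : ℝ) 1, conj (∫ x in Icc (-1 : ℝ) 1, cexp (↑(-2 * π * x * ξ) * I) * (LQ.ev (legL j) x : ℂ))
          * (∫ x in Icc (-1 : ℝ) 1, cexp (↑(-2 * π * x * ξ) * I) * (LQ.ev (legL k) x : ℂ))) - ((midM j k : ℚ) : ℂ)‖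
      ≤ ((radQ : ℚ) : ℝ) := by
  obtain ⟨U, hU, hE⟩ := cert_entries
  have hm : 12 ≤ 2 * mT := by have := cert_rest.2.2.2.2.2.2.2.2.2.2; omega
  rcases le_total j k with hjk | hkj
  · exact norm_entry_sub_mid_le_of_entryOK _ _ _ hU hm (hE j k hjk)
  · rw [cert_rest.2.2.1 j k, show (((midM k j : ℚ) : ℂ)) = (((midM k j : ℚ) : ℝ) : ℂ) by push_cast; rfl,
      norm_entry_swap, show ((((midM k j : ℚ) : ℝ) : ℂ)) = ((midM k j : ℚ) : ℂ) by push_cast; rfl]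
    exact norm_entry_sub_mid_le_of_entryOK _ _ _ hU hm (hE k j hkj)

/-! ## The Legendre vectors and the exponential vectors in `L²[−1,1]` -/

/-- `∫_{[−1,1]} P_j P_k = gramQ j k`. [folklore] -/
theorem setIntegral_ev_mul_ev (j k : Fin 15) :
    ∫ x in Icc (-1 : ℝ) 1, LQ.ev (legL j) x * LQ.ev (legL k) x = ((gramQ j k : ℚ) : ℝ) := by
  rw [integral_Icc_eq_integral_Ioc, ← intervalIntegral.integral_of_le (by norm_num : (-1 : ℝ) ≤ 1)]
  have e : (fun x : ℝ => LQ.ev (legL j) x * LQ.ev (legL k) x) = fun x => LQ.ev (LQ.mul (legL j) (legL k)) x := by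
    funext x; rw [LQ.ev_mul]
  rw [e, LQ.integral_ev, gramQ]
  have e1 : ∀ q : ℚ, LQ.ev (LQ.integ (LQ.mul (legL j) (legL k))) (q : ℝ)
      = ((LQ.evQ (LQ.integ (LQ.mul (legL j) (legL k))) q : ℚ) : ℝ) := fun q => LQ.ev_ratCast _ q
  have := e1 1; have := e1 (-1)
  push_cast at *
  linarith

/-- Inner products of the Legendre vectors: `⟪[P_j], [P_k]⟫ = gramQ j k`. [folklore] -/
theorem inner_legVec (j k : Fin 15) :
    ⟪(memLp_restrict_Icc_of_continuous (continuous_ev_complex (legL j)) 2 (-1) 1).toLp _,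
      (memLp_restrict_Icc_of_continuous (continuous_ev_complex (legL k)) 2 (-1) 1).toLp _⟫_ℂ
      = ((gramQ j k : ℚ) : ℂ) := by
  rw [inner_toLp_toLp]
  have e : (fun x : ℝ => conj (LQ.ev (legL j) x : ℂ) * (LQ.ev (legL k) x : ℂ))
      = fun x : ℝ => ((LQ.ev (legL j) x * LQ.ev (legL k) x : ℝ) : ℂ) := by
    funext x; rw [Complex.conj_ofReal]; push_cast; ring
  rw [e, integral_complex_ofReal, setIntegral_ev_mul_ev]
  norm_cast

/-- `‖[P_j]‖² = gramQ j j`. [folklore] -/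
theorem norm_legVec_sq (j : Fin 15) :
    ‖(memLp_restrict_Icc_of_continuous (continuous_ev_complex (legL j)) 2 (-1) 1).toLp _‖ ^ 2
      = ((gramQ j j : ℚ) : ℝ) := by
  rw [norm_toLp_sq, ← setIntegral_ev_mul_ev j j]
  refine integral_congr_ae (Filter.Eventually.of_forall fun x => ?_)
  show ‖(LQ.ev (legL j) x : ℂ)‖ ^ 2 = LQ.ev (legL j) x * LQ.ev (legL j) x
  rw [Complex.norm_real, Real.norm_eq_abs, sq_abs, sq]

/-- The Legendre vectors are non-zero. [folklore] -/
theorem legVec_ne_zero (j : Fin 15) :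
    (memLp_restrict_Icc_of_continuous (continuous_ev_complex (legL j)) 2 (-1) 1).toLp _ ≠ 0 := by
  intro h
  have h2 := norm_legVec_sq j
  rw [h, norm_zero, zero_pow two_ne_zero] at h2
  have h3 : (2 : ℚ) / 29 ≤ gramQ j j := cert_rest.2.1 j
  have h4 : ((2 / 29 : ℚ) : ℝ) ≤ ((gramQ j j : ℚ) : ℝ) := by exact_mod_cast h3
  rw [← h2] at h4; norm_num at h4

/-- The Legendre vectors are pairwise orthogonal. [folklore] -/
theorem legVec_orthogonal : Pairwise fun j k : Fin 15 =>
    ⟪(memLp_restrict_Icc_of_continuous (continuous_ev_complex (legL j)) 2 (-1) 1).toLp _,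
      (memLp_restrict_Icc_of_continuous (continuous_ev_complex (legL k)) 2 (-1) 1).toLp _⟫_ℂ = 0 := by
  intro j k hjk
  rw [inner_legVec, cert_rest.1 j k hjk]; simp

/-! ## Hypothesis (i): the compressed form -/

/-- The real quadratic form of `Mid` is bounded by `shiftQ·G` (from the `LDLᵀ` identity of file IV). [folklore] -/
theorem quadForm_mid_le (α : Fin 15 → ℝ) :
    ∑ i, ∑ j, α i * α j * ((midM i j : ℚ) : ℝ) ≤ (shiftQ : ℝ) * ∑ i, ((gramQ i i : ℚ) : ℝ) * α i ^ 2 := by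
  obtain ⟨-, -, -, hldl, hd, -⟩ := cert_rest
  have h := dt_quadForm_ge_of_ldl (fun i j => ((((if i = j then shiftQ * gramQ i i else 0) - midM i j : ℚ)) : ℝ))
    (fun r => ((dVec r : ℚ) : ℝ)) (fun r i => ((lMat i r : ℚ) : ℝ)) 0 (fun r => by exact_mod_cast hd r)
    (fun i j => by rw [hldl i j]; push_cast; ring) α
  have hpq : ∀ i j, α i * α j * ((((if i = j then shiftQ * gramQ i i else 0) - midM i j : ℚ)) : ℝ)
      = (if i = j then (shiftQ : ℝ) * ((gramQ i i : ℚ) : ℝ) * α i * α j else 0) - α i * α j * ((midM i j : ℚ) : ℝ) := by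
    intro i j
    by_cases hij : i = j
    · rw [if_pos hij, if_pos hij]; push_cast; ring
    · rw [if_neg hij, if_neg hij]; push_cast; ring
  simp_rw [hpq, Finset.sum_sub_distrib, Finset.sum_ite_eq, Finset.mem_univ, if_true, zero_mul] at h
  have e2 : ∑ i, (shiftQ : ℝ) * ((gramQ i i : ℚ) : ℝ) * α i * α i = (shiftQ : ℝ) * ∑ i, ((gramQ i i : ℚ) : ℝ) * α i ^ 2 := by
    rw [Finset.mul_sum]; exact Finset.sum_congr rfl fun i _ => by ring
  linarith

/-- `Σ_j Σ_k ‖c_j‖ ‖c_k‖ ≤ 15 · Σ_j ‖c_j‖²` on `Fin 15` (Cauchy–Schwarz). [folklore] -/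
theorem sum_sum_norm_mul_norm_le (c : Fin 15 → ℂ) : ∑ j, ∑ k, ‖c j‖ * ‖c k‖ ≤ 15 * ∑ j, ‖c j‖ ^ 2 := by
  rw [← Finset.sum_mul_sum, ← sq]
  have h := sq_sum_le_card_mul_sum_sq (s := (Finset.univ : Finset (Fin 15))) (f := fun j => ‖c j‖)
  simpa [Finset.card_univ, Fintype.card_fin] using h

/-- **Hypothesis (i)**: with `E_j(ξ) = P̂_j(ξ)`, for every `c`,
`∫_{[−1,1]} ‖Σ_j c_j E_j(ξ)‖² dξ ≤ aQ · Σ_j ‖c_j‖² gramQ j j` (and the integrand is integrable). [folklore] -/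
theorem compressed_form_le (c : Fin 15 → ℂ) :
    IntegrableOn (fun ξ : ℝ => ‖∑ j, c j *
        ∫ x in Icc (-1 : ℝ) 1, cexp (↑(-2 * π * x * ξ) * I) * (LQ.ev (legL j) x : ℂ)‖ ^ 2) (Icc (-1 : ℝ) 1) ∧
    ∫ ξ in Icc (-1 : ℝ) 1, ‖∑ j, c j * ∫ x in Icc (-1 : ℝ) 1, cexp (↑(-2 * π * x * ξ) * I) * (LQ.ev (legL j) x : ℂ)‖ ^ 2
      ≤ ((aQ : ℚ) : ℝ) * ∑ j, ‖c j‖ ^ 2 * ((gramQ j j : ℚ) : ℝ) := by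
  set E : Fin 15 → ℝ → ℂ := fun j ξ => ∫ x in Icc (-1 : ℝ) 1, cexp (↑(-2 * π * x * ξ) * I) * (LQ.ev (legL j) x : ℂ)
    with hE
  have hEc : ∀ j, Continuous (E j) := fun j => continuous_polyHat (legL j)
  set M : Fin 15 → Fin 15 → ℂ := fun j k => ∫ ξ in Icc (-1 : ℝ) 1, conj (E j ξ) * E k ξ with hM
  have hMmid : ∀ j k, ‖M j k - ((midM j k : ℚ) : ℂ)‖ ≤ ((radQ : ℚ) : ℝ) := fun j k => norm_entry_sub_mid_le j k
  -- continuity / integrability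
  have hSc : Continuous fun ξ => ∑ j, c j * E j ξ := continuous_finsetSum _ fun j _ => continuous_const.mul (hEc j)
  have hInt : IntegrableOn (fun ξ : ℝ => ‖∑ j, c j * E j ξ‖ ^ 2) (Icc (-1 : ℝ) 1) := (hSc.norm.pow 2).integrableOn_Icc
  refine ⟨hInt, ?_⟩
  -- pointwise: ‖Σ c_j E_j‖² = Re Σ_j Σ_k conj(c_j) c_k conj(E_j) E_k
  have hpt : ∀ ξ, ‖∑ j, c j * E j ξ‖ ^ 2 = (∑ j, ∑ k, conj (c j) * c k * (conj (E j ξ) * E k ξ)).re := by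
    intro ξ
    have h1 : ((‖∑ j, c j * E j ξ‖ ^ 2 : ℝ) : ℂ) = ∑ j, ∑ k, conj (c j) * c k * (conj (E j ξ) * E k ξ) := by
      push_cast
      rw [← Complex.conj_mul', map_sum, Finset.sum_mul_sum]
      refine Finset.sum_congr rfl fun j _ => Finset.sum_congr rfl fun k _ => ?_
      rw [map_mul]; ring
    rw [← h1]; norm_cast
  have hterm : ∀ j k, IntegrableOn (fun ξ : ℝ => conj (c j) * c k * (conj (E j ξ) * E k ξ)) (Icc (-1 : ℝ) 1) :=
    fun j k => (continuous_const.mul ((Complex.continuous_conj.comp (hEc j)).mul (hEc k))).integrableOn_Icc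
  have hF : IntegrableOn (fun ξ : ℝ => ∑ j, ∑ k, conj (c j) * c k * (conj (E j ξ) * E k ξ)) (Icc (-1 : ℝ) 1) :=
    integrable_finsetSum _ fun j _ => integrable_finsetSum _ fun k _ => hterm j k
  have hI : ∫ ξ in Icc (-1 : ℝ) 1, ‖∑ j, c j * E j ξ‖ ^ 2 = (∑ j, ∑ k, conj (c j) * c k * M j k).re := by
    simp_rw [hpt]
    rw [show (fun ξ => (∑ j, ∑ k, conj (c j) * c k * (conj (E j ξ) * E k ξ)).re)
        = fun ξ => RCLike.re (∑ j, ∑ k, conj (c j) * c k * (conj (E j ξ) * E k ξ)) from rfl, integral_re hF]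
    simp only [RCLike.re_to_complex]
    congr 1
    rw [integral_finsetSum _ fun j _ => integrable_finsetSum _ fun k _ => hterm j k]
    refine Finset.sum_congr rfl fun j _ => ?_
    rw [integral_finsetSum _ fun k _ => hterm j k]
    refine Finset.sum_congr rfl fun k _ => ?_
    rw [integral_const_mul]
  rw [hI, Complex.re_sum]
  simp_rw [Complex.re_sum]
  -- split each entry at the midpoint
  have hsplit : ∀ j k, (conj (c j) * c k * M j k).re
      ≤ (c j).re * (c k).re * ((midM j k : ℚ) : ℝ) + (c j).im * (c k).im * ((midM j k : ℚ) : ℝ)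
        + ((radQ : ℚ) : ℝ) * (‖c j‖ * ‖c k‖) := by
    intro j k
    have e : conj (c j) * c k * M j k
        = conj (c j) * c k * ((midM j k : ℚ) : ℂ) + conj (c j) * c k * (M j k - ((midM j k : ℚ) : ℂ)) := by ring
    rw [e, Complex.add_re]
    have h1 : (conj (c j) * c k * ((midM j k : ℚ) : ℂ)).re
        = (c j).re * (c k).re * ((midM j k : ℚ) : ℝ) + (c j).im * (c k).im * ((midM j k : ℚ) : ℝ) := by
      have hre : (conj (c j) * c k).re = (c j).re * (c k).re + (c j).im * (c k).im := by simp [Complex.mul_re]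
      rw [show ((midM j k : ℚ) : ℂ) = (((midM j k : ℚ) : ℝ) : ℂ) by norm_cast, Complex.re_mul_ofReal, hre]
      ring
    have h2 : (conj (c j) * c k * (M j k - ((midM j k : ℚ) : ℂ))).re ≤ ‖c j‖ * ‖c k‖ * ((radQ : ℚ) : ℝ) := by
      refine (Complex.re_le_norm _).trans ?_
      rw [norm_mul, norm_mul, Complex.norm_conj]
      exact mul_le_mul_of_nonneg_left (hMmid j k) (by positivity)
    linarith
  have hQ := quadForm_mid_le (fun j => (c j).re)
  have hQ' := quadForm_mid_le (fun j => (c j).im)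
  have hCS := sum_sum_norm_mul_norm_le c
  obtain ⟨-, hg, -, -, -, -, hbudget, -, haQ, -⟩ := cert_rest
  have hrad : (0 : ℝ) ≤ ((radQ : ℚ) : ℝ) := by rw [radQ]; positivity
  have hnsq : ∀ j, ‖c j‖ ^ 2 = (c j).re ^ 2 + (c j).im ^ 2 := fun j => by
    rw [Complex.sq_norm, Complex.normSq_apply]; ring
  -- sum the pointwise splitting
  have H1 : ∑ j, ∑ k, (conj (c j) * c k * M j k).re
      ≤ ∑ j, ∑ k, ((c j).re * (c k).re * ((midM j k : ℚ) : ℝ) + (c j).im * (c k).im * ((midM j k : ℚ) : ℝ)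
          + ((radQ : ℚ) : ℝ) * (‖c j‖ * ‖c k‖)) :=
    Finset.sum_le_sum fun j _ => Finset.sum_le_sum fun k _ => hsplit j k
  simp only [Finset.sum_add_distrib] at H1
  have H2' : ∑ j, ∑ k, ((radQ : ℚ) : ℝ) * (‖c j‖ * ‖c k‖) = ((radQ : ℚ) : ℝ) * ∑ j, ∑ k, ‖c j‖ * ‖c k‖ := by
    rw [Finset.mul_sum]
    exact Finset.sum_congr rfl fun j _ => by rw [Finset.mul_sum]
  -- the pieces
  set S : ℝ := ∑ j, ((gramQ j j : ℚ) : ℝ) * ‖c j‖ ^ 2 with hS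
  set N : ℝ := ∑ j, ‖c j‖ ^ 2 with hN
  have hSsplit : (∑ j, ((gramQ j j : ℚ) : ℝ) * (c j).re ^ 2) + ∑ j, ((gramQ j j : ℚ) : ℝ) * (c j).im ^ 2 = S := by
    rw [hS, ← Finset.sum_add_distrib]
    exact Finset.sum_congr rfl fun j _ => by rw [hnsq]; ring
  have hSs' : (shiftQ : ℝ) * (∑ j, ((gramQ j j : ℚ) : ℝ) * (c j).re ^ 2)
      + (shiftQ : ℝ) * ∑ j, ((gramQ j j : ℚ) : ℝ) * (c j).im ^ 2 = (shiftQ : ℝ) * S := by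
    rw [← mul_add, hSsplit]
  have hNS : N ≤ 29 / 2 * S := by
    rw [hN, hS, Finset.mul_sum]
    refine Finset.sum_le_sum fun j _ => ?_
    have h29 : ((2 / 29 : ℚ) : ℝ) ≤ ((gramQ j j : ℚ) : ℝ) := by exact_mod_cast hg j
    push_cast at h29
    nlinarith [sq_nonneg ‖c j‖]
  have hS0 : 0 ≤ S := Finset.sum_nonneg fun j _ => by
    have h29 : ((2 / 29 : ℚ) : ℝ) ≤ ((gramQ j j : ℚ) : ℝ) := by exact_mod_cast hg j
    push_cast at h29
    nlinarith [sq_nonneg ‖c j‖]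
  have hbudget' : ((shiftQ + 15 * radQ / (2 / 29) : ℚ) : ℝ) ≤ ((aQ : ℚ) : ℝ) := by exact_mod_cast hbudget
  push_cast at hbudget'
  have H2 : ((radQ : ℚ) : ℝ) * ∑ j, ∑ k, ‖c j‖ * ‖c k‖ ≤ ((radQ : ℚ) : ℝ) * (15 * N) :=
    mul_le_mul_of_nonneg_left hCS hrad
  have H3 : ((radQ : ℚ) : ℝ) * (15 * N) ≤ ((radQ : ℚ) : ℝ) * (15 * (29 / 2 * S)) :=
    mul_le_mul_of_nonneg_left (by linarith) hrad
  have H4 : (((shiftQ : ℚ) : ℝ) + 15 * ((radQ : ℚ) : ℝ) / (2 / 29)) * S ≤ ((aQ : ℚ) : ℝ) * S :=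
    mul_le_mul_of_nonneg_right hbudget' hS0
  have e5 : ((shiftQ : ℚ) : ℝ) * S + ((radQ : ℚ) : ℝ) * (15 * (29 / 2 * S))
      = (((shiftQ : ℚ) : ℝ) + 15 * ((radQ : ℚ) : ℝ) / (2 / 29)) * S := by ring
  have hfin : ∑ j, ‖c j‖ ^ 2 * ((gramQ j j : ℚ) : ℝ) = S := by
    rw [hS]; exact Finset.sum_congr rfl fun j _ => by ring
  rw [hfin]
  linarith [H1, H2', hQ, hQ', H2, H3, H4, hSs', e5]

/-! ## Hypothesis (ii): the tail -/

/-- **Hypothesis (ii)**: `∫_{[−1,1]} (2 − Σ_j ‖P̂_j(ξ)‖²/gramQ j j) dξ ≤ tauQ` (and the integrand is integrable).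
[folklore] -/
theorem tail_le :
    IntegrableOn (fun ξ : ℝ => (2 : ℝ) - ∑ j : Fin 15,
        ‖∫ x in Icc (-1 : ℝ) 1, cexp (↑(-2 * π * x * ξ) * I) * (LQ.ev (legL j) x : ℂ)‖ ^ 2 / ((gramQ j j : ℚ) : ℝ))
      (Icc (-1 : ℝ) 1) ∧
    ∫ ξ in Icc (-1 : ℝ) 1, ((2 : ℝ) - ∑ j : Fin 15,
        ‖∫ x in Icc (-1 : ℝ) 1, cexp (↑(-2 * π * x * ξ) * I) * (LQ.ev (legL j) x : ℂ)‖ ^ 2 / ((gramQ j j : ℚ) : ℝ))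
      ≤ ((tauQ : ℚ) : ℝ) := by
  set E : Fin 15 → ℝ → ℂ := fun j ξ => ∫ x in Icc (-1 : ℝ) 1, cexp (↑(-2 * π * x * ξ) * I) * (LQ.ev (legL j) x : ℂ)
    with hE
  have hEc : ∀ j, Continuous (E j) := fun j => continuous_polyHat (legL j)
  have hterm : ∀ j, IntegrableOn (fun ξ : ℝ => ‖E j ξ‖ ^ 2 / ((gramQ j j : ℚ) : ℝ)) (Icc (-1 : ℝ) 1) := fun j =>
    (((hEc j).norm.pow 2).div_const _).integrableOn_Icc
  have hsum : IntegrableOn (fun ξ : ℝ => ∑ j, ‖E j ξ‖ ^ 2 / ((gramQ j j : ℚ) : ℝ)) (Icc (-1 : ℝ) 1) :=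
    integrable_finsetSum _ fun j _ => hterm j
  have hconst : IntegrableOn (fun _ : ℝ => (2 : ℝ)) (Icc (-1 : ℝ) 1) := by simp
  refine ⟨hconst.sub hsum, ?_⟩
  rw [integral_sub hconst hsum, integral_finsetSum _ fun j _ => hterm j]
  have h2 : ∫ _ in Icc (-1 : ℝ) 1, (2 : ℝ) = 4 := by
    rw [setIntegral_const, smul_eq_mul, Measure.real, Real.volume_Icc]; norm_num
  rw [h2]
  obtain ⟨-, hg, -, -, -, htau, -⟩ := cert_rest
  have hj : ∀ j, (((midM j j : ℚ) : ℝ) - ((radQ : ℚ) : ℝ)) / ((gramQ j j : ℚ) : ℝ)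
      ≤ ∫ ξ in Icc (-1 : ℝ) 1, ‖E j ξ‖ ^ 2 / ((gramQ j j : ℚ) : ℝ) := by
    intro j
    have hgpos : (0 : ℝ) < ((gramQ j j : ℚ) : ℝ) := by
      have := hg j
      have h29 : ((2 / 29 : ℚ) : ℝ) ≤ ((gramQ j j : ℚ) : ℝ) := by exact_mod_cast this
      push_cast at h29; linarith
    rw [integral_div]
    refine div_le_div_of_nonneg_right ?_ hgpos.le
    rw [hE, setIntegral_norm_sq_polyHat_eq_re]
    have hm := norm_entry_sub_mid_le j j
    have hre := Complex.abs_re_le_norm ((∫ ξ in Icc (-1 : ℝ) 1, conj (E j ξ) * E j ξ) - ((midM j j : ℚ) : ℂ))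
    rw [Complex.sub_re, show (((midM j j : ℚ) : ℂ)).re = ((midM j j : ℚ) : ℝ) by norm_cast] at hre
    have := (abs_le.1 (hre.trans hm)).1
    linarith
  have htau' : (4 : ℝ) - ∑ j, (((midM j j : ℚ) : ℝ) - ((radQ : ℚ) : ℝ)) / ((gramQ j j : ℚ) : ℝ) ≤ ((tauQ : ℚ) : ℝ) := by
    have := htau; exact_mod_cast this
  have hs := Finset.sum_le_sum fun j (_ : j ∈ Finset.univ) => hj j
  linarith

/-! ## The main theorem -/

/-- **Band energy of a time-limited function (`c = 2π`)**: for `f ∈ L²(ℝ)` vanishing a.e. off `[−1, 1]`,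
`∫_{[−1,1]} ‖𝓕 f(ξ)‖² dξ ≤ 0.9999428 · ∫ ‖f‖²`; i.e. `1 − λ₀ ≥ 5.72·10⁻⁵` for the top eigenvalue of the time–band
limiting operator behind Sonin's space `S(1,1)` (numerically `λ₀ = 0.99994275335…`).  Certificate: degree-14 Legendre
compression, Taylor order 50, exact `LDLᵀ`, interval Horner at `π²/16` (files I–V). [folklore] -/
theorem integral_norm_sq_fourier_Icc_le {f : ℝ → ℂ} (hf : MemLp f 2 volume)
    (hf0 : ∀ᵐ x : ℝ, x ∉ Icc (-1 : ℝ) 1 → f x = 0) :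
    ∫ ξ in Icc (-1 : ℝ) 1, ‖𝓕 f ξ‖ ^ 2 ≤ (9999428 / 10000000 : ℝ) * ∫ x, ‖f x‖ ^ 2 := by
  -- the Hilbert space objects
  set μI : Measure ℝ := (volume : Measure ℝ).restrict (Icc (-1 : ℝ) 1) with hμI
  set p : Fin 15 → Lp ℂ 2 μI := fun j =>
    (memLp_restrict_Icc_of_continuous (continuous_ev_complex (legL j)) 2 (-1) 1).toLp _ with hp
  set e : ℝ → Lp ℂ 2 μI := fun ξ => (memLp_expKernel ξ (-1) 1).toLp _ with he
  have hfr : MemLp f 2 μI := hf.restrict _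
  set F : Lp ℂ 2 μI := hfr.toLp f with hF
  have hp0 : ∀ j, p j ≠ 0 := fun j => legVec_ne_zero j
  have horth : Pairwise fun j k => ⟪p j, p k⟫_ℂ = 0 := legVec_orthogonal
  have hep : ∀ ξ j, ⟪e ξ, p j⟫_ℂ = ∫ x in Icc (-1 : ℝ) 1, cexp (↑(-2 * π * x * ξ) * I) * (LQ.ev (legL j) x : ℂ) :=
    fun ξ j => inner_expVec_toLp ξ _ _
  have hpn : ∀ j, ‖p j‖ ^ 2 = ((gramQ j j : ℚ) : ℝ) := fun j => norm_legVec_sq j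
  have heF : ∀ ξ, ⟪e ξ, F⟫_ℂ = 𝓕 f ξ := fun ξ => inner_expVec_toLp_eq_fourier ξ _ hfr hf0
  obtain ⟨-, hg, -, -, -, -, -, hsum, haQ, htQ, -⟩ := cert_rest
  -- hypothesis (i)
  have hformInt : ∀ c : Fin 15 → ℂ, Integrable (fun ξ => ‖∑ j, c j * ⟪e ξ, p j⟫_ℂ‖ ^ 2) μI := fun c => by
    simp_rw [hep]; exact (compressed_form_le c).1
  have hform : ∀ c : Fin 15 → ℂ, ∫ ξ, ‖∑ j, c j * ⟪e ξ, p j⟫_ℂ‖ ^ 2 ∂μI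
      ≤ ((aQ : ℚ) : ℝ) * ∑ j, ‖c j‖ ^ 2 * ‖p j‖ ^ 2 := fun c => by
    simp_rw [hep, hpn]; exact (compressed_form_le c).2
  -- hypothesis (ii)
  have htail_pt : ∀ ξ, ‖e ξ - ∑ j, (⟪p j, e ξ⟫_ℂ / ((‖p j‖ : ℂ) ^ 2)) • p j‖ ^ 2
      = 2 - ∑ j, ‖∫ x in Icc (-1 : ℝ) 1, cexp (↑(-2 * π * x * ξ) * I) * (LQ.ev (legL j) x : ℂ)‖ ^ 2
        / ((gramQ j j : ℚ) : ℝ) := by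
    intro ξ
    have h1 := norm_sq_eq_proj_add hp0 horth (e ξ)
    have h2 := norm_proj_sq hp0 horth (e ξ)
    have h3 : ‖e ξ‖ ^ 2 = 2 := norm_expVec_sq ξ _
    rw [h2, h3] at h1
    have h4 : ∀ j, ‖⟪p j, e ξ⟫_ℂ‖ ^ 2 / ‖p j‖ ^ 2
        = ‖∫ x in Icc (-1 : ℝ) 1, cexp (↑(-2 * π * x * ξ) * I) * (LQ.ev (legL j) x : ℂ)‖ ^ 2 / ((gramQ j j : ℚ) : ℝ) := by
      intro j; rw [norm_inner_symm, hep, hpn]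
    simp_rw [h4] at h1
    linarith
  have htailInt : Integrable (fun ξ => ‖e ξ - ∑ j, (⟪p j, e ξ⟫_ℂ / ((‖p j‖ : ℂ) ^ 2)) • p j‖ ^ 2) μI := by
    simp_rw [htail_pt]; exact tail_le.1
  have htail : ∫ ξ, ‖e ξ - ∑ j, (⟪p j, e ξ⟫_ℂ / ((‖p j‖ : ℂ) ^ 2)) • p j‖ ^ 2 ∂μI ≤ ((tauQ : ℚ) : ℝ) := by
    simp_rw [htail_pt]; exact tail_le.2
  -- integrability of `ξ ↦ ‖⟪e ξ, F⟫‖²`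
  have hfi : IntegrableOn f (Icc (-1 : ℝ) 1) := hfr.integrable one_le_two
  have hfInt : Integrable (fun ξ => ‖⟪e ξ, F⟫_ℂ‖ ^ 2) μI := by
    have h : ∀ ξ, ⟪e ξ, F⟫_ℂ = ∫ x in Icc (-1 : ℝ) 1, cexp (↑(-2 * π * x * ξ) * I) * f x := fun ξ => inner_expVec_toLp ξ _ hfr
    simp_rw [h]
    exact ((continuous_setIntegral_fourierKernel hfi).norm.pow 2).integrableOn_Icc
  -- the abstract lemma
  have key := integral_norm_sq_inner_le (μ := μI) p hp0 horth e (by exact_mod_cast haQ) (by exact_mod_cast htQ)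
    hformInt hform htailInt htail F hfInt
  simp_rw [heF] at key
  rw [norm_toLp_restrict_sq_eq hfr hf0] at key
  have hsum' : ((aQ + tauQ : ℚ) : ℝ) ≤ ((9999428 / 10000000 : ℚ) : ℝ) := by exact_mod_cast hsum
  push_cast at hsum'
  have hpos : (0 : ℝ) ≤ ∫ x, ‖f x‖ ^ 2 := integral_nonneg fun _ => by positivity
  exact key.trans (mul_le_mul_of_nonneg_right hsum' hpos)

/-- The same bound with the complementary constant made explicit: `1 − λ₀ ≥ 5.72·10⁻⁵`, i.e.
`∫ ‖f‖² − ∫_{[−1,1]} ‖𝓕 f‖² ≥ (143/2500000) ∫ ‖f‖²`. [folklore] -/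
theorem integral_norm_sq_sub_fourier_Icc_ge {f : ℝ → ℂ} (hf : MemLp f 2 volume)
    (hf0 : ∀ᵐ x : ℝ, x ∉ Icc (-1 : ℝ) 1 → f x = 0) :
    (143 / 2500000 : ℝ) * ∫ x, ‖f x‖ ^ 2 ≤ (∫ x, ‖f x‖ ^ 2) - ∫ ξ in Icc (-1 : ℝ) 1, ‖𝓕 f ξ‖ ^ 2 := by
  have h := integral_norm_sq_fourier_Icc_le hf hf0
  have hpos : (0 : ℝ) ≤ ∫ x, ‖f x‖ ^ 2 := integral_nonneg fun _ => by positivity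
  linarith

end Summit.RiemannHypothesis.RiemannHypothesis.BandEnergy
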